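import Summits.CriticalPhenomena.PercolationContinuityZ3.Theorems.Transplant.PlanarSkeletonFrmFromDefs
import Summits.CriticalPhenomena.PercolationContinuityZ3.Theorems.Transplant.SkelFrmFromBParamsFaceFloorsAYA
import Summits.CriticalPhenomena.PercolationContinuityZ3.Theorems.Transplant.SkelFrmBParamsFaceFloorsAYA
import Summits.CriticalPhenomena.PercolationContinuityZ3.Theorems.Transplant.SkelFrmFromBParamsFaceFloorsTYA
import Summits.CriticalPhenomena.PercolationContinuityZ3.Theorems.Transplant.SkelFrmBParamsFaceFloorsTYA
import Summits.CriticalPhenomena.PercolationContinuityZ3.Theorems.Transplant.SkelFrmFromBParamsFaceFloorsYxE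
import Summits.CriticalPhenomena.PercolationContinuityZ3.Theorems.Transplant.SkelFrmBParamsFaceFloorsYxE
import HarnessLib
import Summits.CriticalPhenomena.PercolationContinuityZ3.Theorems.Transplant.SkelFrmBParamsFaceFloorsYxF
/-!
# U-WAVE PORT (RULING D-U, lead g21 2026-08-26; WAVE-U-MANIFEST v3.1 row «SkelFrmBParamsFaceFloorsYxF» ↦ «SkelFrmFromBParamsFaceFloorsYxF») of the tree module
# `Transplant/SkelFrmBParamsFaceFloorsYxF` onto the carrier `PlanarSkeletonFrmFrom` (frames only, cylinders connected from width `ℓ₀` on)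

ORIGINAL TITLE: N2 (frames-only node, OPEN) — (F) column, (R-49)(c2b) VALUE LAYER part E1: **THE SECOND RUN's ROWS AT THE ONE-STRIDE WINDOW, GENERIC** (hp-8 g43)

builds on p205010 (kernel theorem, internal audit signed; external expert review pending) — nothing in this file uses p205010; NOTHING is claimed about the
OPEN node U `SamePDropOfSkeletonFrmFrom₁` (nor U_s / the end state).  Lane `prim-bschramm`, seat `prim-bschramm-stmt` gen 26 (port pen, RULING M-11 family P-stmt; tool = p3-g26's port_u.py of record, registry-driven inputs); helper file
(`--supports stmt-CriticalPhenomena-4575 --as helper`).  PORT RULES r1–r4 of RULING D-U: declaration order and proof texts are those of the original,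
byte-identical except (i) the carrier token `PlanarSkeletonFrm ↦ PlanarSkeletonFrmFrom` (binders, `namespace`/`end` lines, qualified names of twinned
declarations), (ii) carrier-FREE declarations of the original (φ-level `Skelφ…` blocks and namespace-only arithmetic residents) are NOT re-declared —
this file imports the original and `export`s the twin-free residents (POLICY T / treatment (m1)); residents whose statement mentions a twinned
constant are copied, (iii) every carrier-binding declaration keeps its explicit binder `(Φ : PlanarSkeletonFrmFrom G)` in its own signature (r2).  Docstrings and citations are the original's.
-/

noncomputable section

open scoped Classical

namespace Summit.CriticalPhenomena.PercolationContinuityZ3.Theorems.Transplant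

namespace PlanarSkeletonFrmFrom

namespace NegB

open Literature.Probability.Percolation Literature.Probability.LatticeModels SimpleGraph
open SkelConc (Consts)
open Skelφ (shearUnit shearUnit_pos yBoxLoS yBoxHiS ySLo ySHi yBnd)
open Skelφ.StepI (DataN)
open TwoAxis.Para (modulus)
open Neg

namespace KS

/-- **Lower LEVEL row of region `k`** (generic floor `G`): `G + 5u₁ + 1 ≤ F1cA yT + u₁·k ⇒ m·(G − F1cA yT) ≤ u₁·(U·(ySLo k − 1)) − m + 1`
(`ySBox_env` + `ySBox_err_le600`). [cite: KozmaNitzan2024, §4 Lemma 12 (pp. 23–25)] -/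
theorem FYlo_Yx (κ : Consts) {V : Type} [DecidableEq V] [Countable V] {G : SimpleGraph V} [G.LocallyFinite] (Φ : PlanarSkeletonFrmFrom G) (t : V) (p : unitInterval) (D : Skelφ.StepI.DataNS V) (g : ℕ) (f : ℕ) (mk : ℕ) (hN : EqNumL κ Φ t p D g f) (hκ : (hL κ Φ t p D g f).natAbs ≤ 10 * nL κ Φ t p D g f)
    (hℓ : 22000 * Neg.Kq κ * ((KS0.R'0 κ Φ t p D mk) + 2) ≤ ℓL κ Φ t p D g f) (yT : Site 2) {G : ℤ} {k : ℕ} (hk : k + 1 ≤ 600 * Neg.Kq κ)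
    (hlo : G + 5 * u₁A κ Φ t p D g f + 1 ≤ F1cA κ Φ t p D g f yT + 1 * u₁A κ Φ t p D g f * (k : ℤ)) :
    modulus (nL κ Φ t p D g f) (hL κ Φ t p D g f) (vL κ Φ t p D g f) (vβL κ Φ t p D g f) * (G - F1cA κ Φ t p D g f yT) ≤
      u₁A κ Φ t p D g f * ((shearUnit (nL κ Φ t p D g f) (hL κ Φ t p D g f) : ℤ) * (ySLo (nL κ Φ t p D g f) (ℓL κ Φ t p D g f) (hL κ Φ t p D g f) (qB3XA κ Φ t p D g f (KS0.R'0 κ Φ t p D mk)) (KS0.R'0 κ Φ t p D mk) 1 k - 1)) - modulus (nL κ Φ t p D g f) (hL κ Φ t p D g f) (vL κ Φ t p D g f) (vβL κ Φ t p D g f) + 1 := by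
  obtain ⟨hn1, hℓ1⟩ := one_le_of_eqNumL κ Φ t p D g f hN
  have hm0 : 0 < modulus (nL κ Φ t p D g f) (hL κ Φ t p D g f) (vL κ Φ t p D g f) (vβL κ Φ t p D g f) := Skelφ.NegPrm.modulus_vβOf_pos hn1 hℓ1 _ _
  have hu : 1 ≤ u₁A κ Φ t p D g f := (units_eqA κ Φ t p D g f).2.2.2.2.2
  have hτ : (1 : ℤ) = 1 ∨ (1 : ℤ) = -1 := Or.inl rfl
  obtain ⟨hlb, -⟩ := ySBox_env κ Φ t p D g f hN hτ (qB3XA κ Φ t p D g f (KS0.R'0 κ Φ t p D mk)) (KS0.R'0 κ Φ t p D mk) k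
  have herr := ySBox_err_le600 κ Φ t p D g f mk hN hκ hℓ hk
  clear hℓ hk hκ
  set m := modulus (nL κ Φ t p D g f) (hL κ Φ t p D g f) (vL κ Φ t p D g f) (vβL κ Φ t p D g f)
  set u := u₁A κ Φ t p D g f
  set U : ℤ := (shearUnit (nL κ Φ t p D g f) (hL κ Φ t p D g f) : ℤ)
  set S := ySLo (nL κ Φ t p D g f) (ℓL κ Φ t p D g f) (hL κ Φ t p D g f) (qB3XA κ Φ t p D g f (KS0.R'0 κ Φ t p D mk)) (KS0.R'0 κ Φ t p D mk) 1 k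
  set Err := 2 * (k : ℤ) * U + U * (qB3XA κ Φ t p D g f (KS0.R'0 κ Φ t p D mk) : ℕ) + U * (((k : ℤ) + 1) * ((KS0.R'0 κ Φ t p D mk) : ℕ)) + 3 * ((nL κ Φ t p D g f : ℤ) * ℓL κ Φ t p D g f) + U
  set F := F1cA κ Φ t p D g f yT
  have h1 : u * (1 * (k : ℤ) * m - Err - U) ≤ u * (U * (S - 1)) := mul_le_mul_of_nonneg_left (by linarith) (by linarith)
  have h2 : u * (Err + U) ≤ u * (5 * m) := mul_le_mul_of_nonneg_left herr (by linarith)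
  have h3 : m * (5 * u + 1) ≤ m * (-G + F + 1 * u * (k : ℤ)) := mul_le_mul_of_nonneg_left (by linarith) hm0.le
  nlinarith

/-- **Upper LEVEL row of region `k`** (generic ceiling `H`): `F1cA yT + u₁·k + 5u₁ + 1 ≤ H ⇒ m·(F1cA yT + 1) + u₁·(U·ySHi k + U − 1) ≤ m·H`. [cite: KozmaNitzan2024, §4 Lemma 12 (pp. 23–25)] -/
theorem FYhi_Yx (κ : Consts) {V : Type} [DecidableEq V] [Countable V] {G : SimpleGraph V} [G.LocallyFinite] (Φ : PlanarSkeletonFrmFrom G) (t : V) (p : unitInterval) (D : Skelφ.StepI.DataNS V) (g : ℕ) (f : ℕ) (mk : ℕ) (hN : EqNumL κ Φ t p D g f) (hκ : (hL κ Φ t p D g f).natAbs ≤ 10 * nL κ Φ t p D g f)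
    (hℓ : 22000 * Neg.Kq κ * ((KS0.R'0 κ Φ t p D mk) + 2) ≤ ℓL κ Φ t p D g f) (yT : Site 2) {H : ℤ} {k : ℕ} (hk : k + 1 ≤ 600 * Neg.Kq κ)
    (hhi : F1cA κ Φ t p D g f yT + 1 * u₁A κ Φ t p D g f * (k : ℤ) + 5 * u₁A κ Φ t p D g f + 1 ≤ H) :
    modulus (nL κ Φ t p D g f) (hL κ Φ t p D g f) (vL κ Φ t p D g f) (vβL κ Φ t p D g f) * (F1cA κ Φ t p D g f yT + 1) +
        u₁A κ Φ t p D g f * ((shearUnit (nL κ Φ t p D g f) (hL κ Φ t p D g f) : ℤ) * ySHi (nL κ Φ t p D g f) (ℓL κ Φ t p D g f) (hL κ Φ t p D g f) (qB3XA κ Φ t p D g f (KS0.R'0 κ Φ t p D mk)) (KS0.R'0 κ Φ t p D mk) 1 k + shearUnit (nL κ Φ t p D g f) (hL κ Φ t p D g f) - 1) ≤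
      modulus (nL κ Φ t p D g f) (hL κ Φ t p D g f) (vL κ Φ t p D g f) (vβL κ Φ t p D g f) * H := by
  obtain ⟨hn1, hℓ1⟩ := one_le_of_eqNumL κ Φ t p D g f hN
  have hm0 : 0 < modulus (nL κ Φ t p D g f) (hL κ Φ t p D g f) (vL κ Φ t p D g f) (vβL κ Φ t p D g f) := Skelφ.NegPrm.modulus_vβOf_pos hn1 hℓ1 _ _
  have hu : 1 ≤ u₁A κ Φ t p D g f := (units_eqA κ Φ t p D g f).2.2.2.2.2
  have hτ : (1 : ℤ) = 1 ∨ (1 : ℤ) = -1 := Or.inl rfl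
  obtain ⟨-, hub⟩ := ySBox_env κ Φ t p D g f hN hτ (qB3XA κ Φ t p D g f (KS0.R'0 κ Φ t p D mk)) (KS0.R'0 κ Φ t p D mk) k
  have herr := ySBox_err_le600 κ Φ t p D g f mk hN hκ hℓ hk
  clear hℓ hk hκ
  set m := modulus (nL κ Φ t p D g f) (hL κ Φ t p D g f) (vL κ Φ t p D g f) (vβL κ Φ t p D g f)
  set u := u₁A κ Φ t p D g f
  set U : ℤ := (shearUnit (nL κ Φ t p D g f) (hL κ Φ t p D g f) : ℤ)
  set S := ySHi (nL κ Φ t p D g f) (ℓL κ Φ t p D g f) (hL κ Φ t p D g f) (qB3XA κ Φ t p D g f (KS0.R'0 κ Φ t p D mk)) (KS0.R'0 κ Φ t p D mk) 1 k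
  set Err := 2 * (k : ℤ) * U + U * (qB3XA κ Φ t p D g f (KS0.R'0 κ Φ t p D mk) : ℕ) + U * (((k : ℤ) + 1) * ((KS0.R'0 κ Φ t p D mk) : ℕ)) + 3 * ((nL κ Φ t p D g f : ℤ) * ℓL κ Φ t p D g f) + U
  set F := F1cA κ Φ t p D g f yT
  have h1 : u * (U * S + U - 1) ≤ u * (1 * (k : ℤ) * m + Err + U) := mul_le_mul_of_nonneg_left (by linarith) (by linarith)
  have h2 : u * (Err + U) ≤ u * (5 * m) := mul_le_mul_of_nonneg_left herr (by linarith)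
  have h3 : m * (F + 1 * u * (k : ℤ) + 5 * u + 1) ≤ m * H := mul_le_mul_of_nonneg_left hhi hm0.le
  nlinarith

/-- **Lower ABSCISSA row of region `k`** (room `fw` generic): `−fw + 9u₀ + 1 ≤ FcA yT ⇒ n·m·(−fw − FcA yT) ≤ −u₀·(yBnd k + 2n) − n·m` (`yBnd_env600`). [cite: KozmaNitzan2024, §4 Lemma 12 (pp. 23–25)] -/
theorem FWlo_Yx (κ : Consts) {V : Type} [DecidableEq V] [Countable V] {G : SimpleGraph V} [G.LocallyFinite] (Φ : PlanarSkeletonFrmFrom G) (t : V) (p : unitInterval) (D : Skelφ.StepI.DataNS V) (g : ℕ) (f : ℕ) (mk : ℕ) (hN : EqNumL κ Φ t p D g f) (hκ : (hL κ Φ t p D g f).natAbs ≤ 10 * nL κ Φ t p D g f)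
    (hnA24 : 2400 * Neg.Kq κ * ((KS0.R'0 κ Φ t p D mk) + 2) ≤ nL κ Φ t p D g f) (hℓ : 22000 * Neg.Kq κ * ((KS0.R'0 κ Φ t p D mk) + 2) ≤ ℓL κ Φ t p D g f)
    (yT : Site 2) {fw : ℤ} {k : ℕ} (hk : k + 1 ≤ 600 * Neg.Kq κ) (hlo : -fw + 9 * u₀A κ Φ t p D g f + 1 ≤ FcA κ Φ t p D g f yT) :
    (nL κ Φ t p D g f : ℤ) * modulus (nL κ Φ t p D g f) (hL κ Φ t p D g f) (vL κ Φ t p D g f) (vβL κ Φ t p D g f) * (-fw - FcA κ Φ t p D g f yT) ≤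
      -(u₀A κ Φ t p D g f * (yBnd (nL κ Φ t p D g f) (ℓL κ Φ t p D g f) (hL κ Φ t p D g f) (modulus (nL κ Φ t p D g f) (hL κ Φ t p D g f) (vL κ Φ t p D g f) (vβL κ Φ t p D g f)) (qB3XA κ Φ t p D g f (KS0.R'0 κ Φ t p D mk)) (KS0.R'0 κ Φ t p D mk) k + 2 * (nL κ Φ t p D g f : ℤ))) -
        (nL κ Φ t p D g f : ℤ) * modulus (nL κ Φ t p D g f) (hL κ Φ t p D g f) (vL κ Φ t p D g f) (vβL κ Φ t p D g f) := by
  obtain ⟨hn1, hℓ1⟩ := one_le_of_eqNumL κ Φ t p D g f hN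
  have hm0 : 0 < modulus (nL κ Φ t p D g f) (hL κ Φ t p D g f) (vL κ Φ t p D g f) (vβL κ Φ t p D g f) := Skelφ.NegPrm.modulus_vβOf_pos hn1 hℓ1 _ _
  have hu : 1 ≤ u₀A κ Φ t p D g f := (units_eqA κ Φ t p D g f).2.2.2.2.1
  have henv := yBnd_env600 κ Φ t p D g f mk hN hκ hnA24 hℓ hk (by linarith : (0 : ℤ) ≤ u₀A κ Φ t p D g f)
  have hn1' : (1 : ℤ) ≤ (nL κ Φ t p D g f : ℤ) := by exact_mod_cast hn1
  set n : ℤ := (nL κ Φ t p D g f : ℤ)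
  set m := modulus (nL κ Φ t p D g f) (hL κ Φ t p D g f) (vL κ Φ t p D g f) (vβL κ Φ t p D g f)
  set u := u₀A κ Φ t p D g f
  set F := FcA κ Φ t p D g f yT
  have hnm : 0 < n * m := mul_pos (by linarith) hm0
  have key : n * m * (-fw - F) ≤ n * m * (-(9 * u) - 1) := mul_le_mul_of_nonneg_left (by linarith) hnm.le
  nlinarith

/-- **Upper ABSCISSA row of region `k`** (room `fw` generic): `FcA yT + 9u₀ + 1 ≤ fw ⇒ n·m·(FcA yT + 1) + u₀·(yBnd k + n) ≤ n·m·fw`. [cite: KozmaNitzan2024, §4 Lemma 12 (pp. 23–25)] -/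
theorem FWhi_Yx (κ : Consts) {V : Type} [DecidableEq V] [Countable V] {G : SimpleGraph V} [G.LocallyFinite] (Φ : PlanarSkeletonFrmFrom G) (t : V) (p : unitInterval) (D : Skelφ.StepI.DataNS V) (g : ℕ) (f : ℕ) (mk : ℕ) (hN : EqNumL κ Φ t p D g f) (hκ : (hL κ Φ t p D g f).natAbs ≤ 10 * nL κ Φ t p D g f)
    (hnA24 : 2400 * Neg.Kq κ * ((KS0.R'0 κ Φ t p D mk) + 2) ≤ nL κ Φ t p D g f) (hℓ : 22000 * Neg.Kq κ * ((KS0.R'0 κ Φ t p D mk) + 2) ≤ ℓL κ Φ t p D g f)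
    (yT : Site 2) {fw : ℤ} {k : ℕ} (hk : k + 1 ≤ 600 * Neg.Kq κ) (hhi : FcA κ Φ t p D g f yT + 9 * u₀A κ Φ t p D g f + 1 ≤ fw) :
    (nL κ Φ t p D g f : ℤ) * modulus (nL κ Φ t p D g f) (hL κ Φ t p D g f) (vL κ Φ t p D g f) (vβL κ Φ t p D g f) * (FcA κ Φ t p D g f yT + 1) +
        u₀A κ Φ t p D g f * (yBnd (nL κ Φ t p D g f) (ℓL κ Φ t p D g f) (hL κ Φ t p D g f) (modulus (nL κ Φ t p D g f) (hL κ Φ t p D g f) (vL κ Φ t p D g f) (vβL κ Φ t p D g f)) (qB3XA κ Φ t p D g f (KS0.R'0 κ Φ t p D mk)) (KS0.R'0 κ Φ t p D mk) k + nL κ Φ t p D g f) ≤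
      (nL κ Φ t p D g f : ℤ) * modulus (nL κ Φ t p D g f) (hL κ Φ t p D g f) (vL κ Φ t p D g f) (vβL κ Φ t p D g f) * fw := by
  obtain ⟨hn1, hℓ1⟩ := one_le_of_eqNumL κ Φ t p D g f hN
  have hm0 : 0 < modulus (nL κ Φ t p D g f) (hL κ Φ t p D g f) (vL κ Φ t p D g f) (vβL κ Φ t p D g f) := Skelφ.NegPrm.modulus_vβOf_pos hn1 hℓ1 _ _
  have hu : 1 ≤ u₀A κ Φ t p D g f := (units_eqA κ Φ t p D g f).2.2.2.2.1
  have henv := yBnd_env600 κ Φ t p D g f mk hN hκ hnA24 hℓ hk (by linarith : (0 : ℤ) ≤ u₀A κ Φ t p D g f)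
  have hn1' : (1 : ℤ) ≤ (nL κ Φ t p D g f : ℤ) := by exact_mod_cast hn1
  set n : ℤ := (nL κ Φ t p D g f : ℤ)
  set m := modulus (nL κ Φ t p D g f) (hL κ Φ t p D g f) (vL κ Φ t p D g f) (vβL κ Φ t p D g f)
  set u := u₀A κ Φ t p D g f
  set F := FcA κ Φ t p D g f yT
  have hnm : 0 < n * m := mul_pos (by linarith) hm0
  have hun : 0 ≤ u * n := mul_nonneg (by linarith) (by linarith)
  have key : n * m * (F + 1 + 9 * u) ≤ n * m * fw := mul_le_mul_of_nonneg_left (by linarith) hnm.le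
  nlinarith

end KS

end NegB

end PlanarSkeletonFrmFrom

end Summit.CriticalPhenomena.PercolationContinuityZ3.Theorems.Transplant

end
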